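import Summits.BirchSwinnertonDyer.BirchSwinnertonDyer.Theorems.EisensteinPrimesMazurMCOnCellBTwistbackTwoStepShaUnitLevel
import Summits.BirchSwinnertonDyer.BirchSwinnertonDyer.Theorems.SchneiderFreeAdditiveX3PoitouTateSelmerDualityHolds
import Summits.BirchSwinnertonDyer.BirchSwinnertonDyer.Theorems.SchneiderFreeAdditiveX3PoitouTateShaDualityHolds
import Summits.BirchSwinnertonDyer.BirchSwinnertonDyer.Theorems.EisensteinPrimesMazurMCOnCellBTwistbackUnitEndCell70971a1
import Summits.BirchSwinnertonDyer.BirchSwinnertonDyer.Theorems.Rank2ShaTierKitW16P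
import Summits.BirchSwinnertonDyer.BirchSwinnertonDyer.Theorems.EisensteinPrimesMazurMCOnCellBTwistbackUnitEndP5Cell395c1
import Summits.BirchSwinnertonDyer.Rank1Residual.X1.DoubleTwistDisplayKit
import Summits.BirchSwinnertonDyer.Rank1Residual.X2.RouteGSplitDisplay329718a1Local
import Summits.BirchSwinnertonDyer.Rank1Residual.X2.TwistParityStability
import Literature.NumberTheory.EllipticCurves.TateCurve.NumberFieldUniformization
import Literature.NumberTheory.EllipticCurves.TateCurve.NumberFieldUniformizationTwisted
import Literature.NumberTheory.EllipticCurves.HeegnerHypothesisKroneckerProofs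
import Literature.NumberTheory.EllipticCurves.HeegnerFieldOfDiscriminantProofs
import Literature.NumberTheory.EllipticCurves.ModularityVersionApProofs
import Literature.NumberTheory.EllipticCurves.MazurTorsionGaloisStructureProofs
import Mathlib.Tactic.NormNum.LegendreSymbol
import HarnessLib

/-!
# Crux 3 `MazurMCOnCellB` (stmt-BirchSwinnertonDyer-19033), line `twistback` v12 — ROAD (e) «TWO-STEP Ш-UNIT» DISPLAYED
# AT A PRIME `p = 7`: the SPLIT X2b pair `(546f1, 7)` (`546f1 = [1, 0, 0, 714, -82908]`, `N = 546 = 2·3·7·13`) — the first road-(e) display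
# of the line outside the `p = 3` atlas A10; every decidable side condition in the kernel; two admissible fields
# `ℚ(√-503)`, `ℚ(√-335)` and FOUR instrument readings

Width seat bsd-line-x2-p1-w5 (g5), cell `bsd-eis` (run/shared/lean/pub/bsd-eis/), 2026-08-29; `--supports stmt-BirchSwinnertonDyer-19033
--as helper`. THEOREMS ONLY (no `def`, no named fact introduced, no `sorry`, no instance); format of w5 g3/g4's
`…UnitEndCell<label>` files, base facts in-file as in `…UnitEndCell279150d1` (`isElliptic`/`isGloballyMinimal` of `395c1` REUSED BY NAME:
`AdditiveBranchIMCGordTwoRankZeroCompanion.isElliptic_cV3555e1` / `isGloballyMinimal_cV3555e1`). WHY: the crux quantifies over ALL primes `p`; every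
per-pair display on file sits at `p = 3` (A10); the two-step closer `mazurMainConjectureAt_of_cellB_of_twoStepShaUnit_of_levels` (w6 g2)
and `X2.not_gvPar_of_nsmul_eq_zero_of_mult` are `p`-generic and cell b2b-bsdr2sha's `Rank2Sha.fiveTorsCheck` certifies a rational point
of order `7` in the kernel, so the road opens verbatim at `p = 7`; this file is that opening on the smallest semistable example found.

WHAT. `546f1 = [1, 0, 0, 714, -82908]` (Cremona: the ONLY curve of conductor `< 10⁴` with a rational `7`-torsion point, `7 ∥ N` and rank `0`;
`#T = 7`, `∏c = 343`, `Ω = 0.38165254`, `L(E,1) = 2.67156776`, `#Ш_an = 1`) is the reduced minimal model of the Kubert–Tate `X₁(7)` curve at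
`d = 7` (`[−41, −294, −294, 0, 0]`, shift `⟨1, −42, 21, −714⟩`): `N = 546 = 2·3·7·13` (`|Δ| = 2⁷·3⁷·7⁷·13`, `c₄ = −34271`); SPLIT multiplicative
at `2`, `3`, `7` (node-tangent root `t = 0` mod `7`), non-split at `13`; rational point `T = (42, −168)` of ORDER `7` (`2T = (336, 6006)`,
`4T = (84, 714)`, `8T = T`; three tangent certificates), hence `E[7]` reducible and `¬ GVPar (E, 7)`; `c₂ = c₃ = c₇ = 7`, `c₁₃ = 1`, no rational
`2`-torsion, no quadratic-character line in `E[3]` or `E[5]` (`a₁₁ = 5`); root number `+1`. `2 ∣ N` ⇒ admissible `d ≡ 1 (mod 8)` with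
`(d/3) = (d/7) = (d/13) = +1`: the admissible `d_K` start `−311, −335, −503, −647, …`; the first two admissible paths `(−335, −311)` (`D = 104185`)
and `(−503, −311)` (`D = 156433`) end in rank `≥ 2` (`L(E^D,1) = 0` to `10⁻⁹`); the third, `(−503, −335)`, is a `7`-adic Ш-unit end.
* FIRST STEP `K = ℚ(√-503)`: `-503 ≡ 1 (mod 8)`, `(-503/q) = +1` for `q ∈ {3, 7, 13}`; the partner
  `Wd = 546f1 ⊗ χ_{-503} = [1, 0, 0, 180643155, 10558751582673]` (globally minimal, PROVED; `⟨1, 42, 1 / 2, 0⟩⁻¹ • Wd =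
  546f1.quadraticTwist (-503)`, PROVED) has root number `−1` and — READING — `L′(Wd, 1) = 50.1872270 ≠ 0`.
* SECOND STEP `K″ = ℚ(√-335)` (`-335 = −5·67`): `-335 ≡ 1 (mod 8)`, `(-335/q) = +1` for `q ∈ {3, 7, 13, 503}`; the double twist
  `W″ = Wd ⊗ χ_{-335} = 546f1 ⊗ χ_{168505} = [1, 0, 0, 20272678067537, -396959657647449024583]` (globally minimal, PROVED; `⟨1, 28, 1 / 2, 0⟩⁻¹ • W″ =
  Wd.quadraticTwist (-335)`, PROVED) has — READINGS — `L(W″, 1) = 5.10241596 ≠ 0` and `#Ш_an(W″) = 4` (`W″(ℚ)_tors = 0`, Tamagawa `7·7·7·1·1·2·2` at `2, 3, 7, 13, 5, 67, 503`, `Ω(W″) = 0.000929741`, `L/Ω = 5488 = 4·1372`), a `7`-adic unit.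
* `X2.CellB (546f1) 5` from the rank reading; good reduction off `{2, 3, 7, 13}`; Heegner hypotheses for `N`, for `7` and for `503`
  by `d ≡ 1 (mod 8)` + Kronecker symbols (`X1.DoubleTwistDisplayKit.satisfiesHeegnerHypothesis_of_jacobiSym`).
NUMERICS OF RECORD (seat evidence `ROAD-E-P5-WITNESS-w5g5.md` on -19033, mirror `HOME/line-x2-p1-w5-g5/`): source =
this seat's local engine (w5 g4 engine v2 `roade2.py` a_p/BSGS + exact twist models `twistdata.py`);
path `(-503, -335)`, `D = 168505`, `N·D² = 15503088523650`: `L′(Wd,1) = 50.1872270`, `L(W″,1) = 5.10241596`, `#Ш_an(W″) = 4`.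
HYPOTHESES LEFT, BY NAME: the v12 cone — `PublishedInputs` (item 19037), Wuthrich 2014 Prop. 21, Hsieh 2014 Thm. 1, LZZ 2018
Thms. 1.5.1/1.5.3, Mazur 1978 Cor. 4.1 (PUBLISHED), Keller–Yin Thm. D (PREPRINT) — and FOUR readings `hr`, `hrd`, `hL`, `hunit`;
Poitou–Tate ×2 discharged (bsd-schneider `_holds`). HONEST FRAMING: nothing is booked; `(546f1, 7)` is NOT closed by this file; the
named facts are typed for general `p` but were READ by their typists with the `p = 3` programme in view — whether each printed
hypothesis set covers `p = 7` at this pair is NOT re-audited here; Mazur's main conjecture / BSD is proved for NO curve; no summit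
statement is proved; closes no registered stub; 0 cells / labels / stubs / tiers move. References: [Wuthrich2014] Thm. 16, Prop. 21;
[KellerYin2024] Thm. D (PRE); [LiuZhangZhang2018]; [Hsieh2014]; [Mazur1978] Cor. 4.1; [SilvermanATAEC1994] V.5.3–5.4;
[SilvermanAEC2009] III.2.3, VII.1, VII.5; [GrossLMS1991] §1; [Mazur1977] III.5.
-/
set_option autoImplicit false
-- `Summit.BirchSwinnertonDyer.BirchSwinnertonDyer.…`: the summit and its single sub-problem share a name.
set_option linter.dupNamespace false
noncomputable section
open scoped Classical
open WeierstrassCurve NumberField IsDedekindDomain Literature.NumberTheory.EllipticCurves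
  Literature.NumberTheory.EllipticCurves.ModularForms Literature.NumberTheory.EllipticCurves.Rank1Residual
  Literature.NumberTheory.EllipticCurves.Rank1Residual.Typed
  Literature.NumberTheory.EllipticCurves.Rank1Residual.X11RankOneCertificates
  Literature.NumberTheory.EllipticCurves.Wuthrich2014 Literature.NumberTheory.EllipticCurves.KellerYin2024
  Literature.NumberTheory.EllipticCurves.TateCurve Literature.NumberTheory.GaloisCohomology
  Summit.BirchSwinnertonDyer.BirchSwinnertonDyer.Rank1Residual.IntModel
  Summit.BirchSwinnertonDyer.BirchSwinnertonDyer.Rank1Residual.X11RankOne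
  Summit.BirchSwinnertonDyer.Rank1Residual.X11b Summit.BirchSwinnertonDyer.Rank1Residual
  Summit.BirchSwinnertonDyer.Rank1Residual.X2
  Summit.BirchSwinnertonDyer.Rank1Residual.X2.RouteGSplitDisplay329718a1Local
  Summit.BirchSwinnertonDyer.BirchSwinnertonDyer.Theses Summit.BirchSwinnertonDyer.BirchSwinnertonDyer.Theorems
  Summit.BirchSwinnertonDyer.BirchSwinnertonDyer.Theorems.EisensteinPrimesMazurMCOnCellBTwistbackTwoStepShaUnit
  Summit.BirchSwinnertonDyer.BirchSwinnertonDyer.Theorems.EisensteinPrimesMazurMCOnCellBTwistbackTwoStepShaUnitLevel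

namespace Summit.BirchSwinnertonDyer.BirchSwinnertonDyer.Theorems.EisensteinPrimesMazurMCOnCellBTwistbackUnitEndP7Cell546f1
/-! ## §1 The base pair `(546f1, 7)`: split at `7`, the rational point of order `7`, `E[7]` reducible, `¬ GVPar`, `X2.CellB`, good reduction off `{2, 3, 7, 13}`, Heegner for `N` -/

/-- `546f1 = [1, 0, 0, 714, -82908]` is elliptic (`|Δ| = 2⁷·3⁷·7⁷·13 ≠ 0`). [folklore] -/
theorem isElliptic_546f1 : (⟨1, 0, 0, 714, -82908⟩ : WeierstrassCurve ℚ).IsElliptic :=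
  isElliptic_of_discOf_ne_zero 1 0 0 714 (-82908) (by decide +kernel)

set_option maxRecDepth 100000 in
/-- `546f1` is globally minimal (support-form Kraus–Silverman criterion on `|Δ| = 2⁷·3⁷·7⁷·13`).
[cite: SilvermanAEC2009, VII.1 Remark 1.1] [cite: Kraus1989, Prop. 1 and Prop. 2] -/
theorem isGloballyMinimal_546f1 : (⟨1, 0, 0, 714, -82908⟩ : WeierstrassCurve ℚ).IsGloballyMinimal :=
  X11b.isGloballyMinimal_of_krausCriterion_support 1 0 0 714 (-82908)
    [(2, 1, 7), (3, 1, 7), (7, 1, 7), (13, 1, 1)] (by intro t ht; fin_cases ht <;> norm_num)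
    (by decide +kernel) (by decide +kernel)

/-- **`546f1` is SPLIT multiplicative at `7`** (`7 ∣ Δ`, `7 ∤ c₄ = -34271`; node-tangent root `t = 0` mod `7`).
[cite: SilvermanAEC2009, VII.5 Prop. 5.1(b)] -/
theorem split_546f1 : (⟨1, 0, 0, 714, -82908⟩ : WeierstrassCurve ℚ).HasSplitMultiplicativeReductionAtPrime 7 := by
  haveI := isElliptic_546f1
  haveI := isGloballyMinimal_546f1
  have hI := integralModelInt_eq_of_map_eq (W := (⟨1, 0, 0, 714, -82908⟩ : WeierstrassCurve ℚ)) _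
    (map_mk_int 1 0 0 714 (-82908))
  refine hasSplitMultiplicativeReductionAtPrime_of_intModel_of_root hI 7
    (by rw [intCurve_Δ]; decide +kernel) (by rw [intCurve_c₄]; decide +kernel) ⟨0, ?_⟩
  simp only [WeierstrassCurve.c₄, WeierstrassCurve.b₂, WeierstrassCurve.b₄, WeierstrassCurve.b₆]
  push_cast
  decide

/-- **Kernel certificate of a rational point of ORDER `7`** on an integer model (THEOREM, no new `def`): integral points `T`, `2T`, `4T`
with three tangent certificates `T + T = 2T`, `2T + 2T = 4T`, `4T + 4T = T` (cell b2b-bsdr2sha's `Rank2Observatory.intTangent` /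
`some_add_self_of_intTangent`, exactly as its `Rank2Sha.exists_addOrderOf_eq_five_of_fiveTorsCheck`); then `8T = T`, so `7T = 0` with `T ≠ 0`.
[cite: SilvermanAEC2009, III.2.3] -/
theorem exists_addOrderOf_eq_seven_of_intTangent {e : WeierstrassCurve ℤ} {x₁ y₁ x₂ y₂ x₄ y₄ : ℤ} (hΔ : e.Δ ≠ 0)
    (h₁ : Rank2Observatory.onCurveZ e x₁ y₁ = true) (h₂ : Rank2Observatory.onCurveZ e x₂ y₂ = true)
    (h₄ : Rank2Observatory.onCurveZ e x₄ y₄ = true) (t₁ : Rank2Observatory.intTangent e x₁ y₁ x₂ y₂ = true)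
    (t₂ : Rank2Observatory.intTangent e x₂ y₂ x₄ y₄ = true) (t₄ : Rank2Observatory.intTangent e x₄ y₄ x₁ y₁ = true) :
    ∃ T : (e.map (Int.castRingHom ℚ)).toAffine.Point, addOrderOf T = 7 := by
  have h₁' := Rank2Observatory.onCurveZ_spec e h₁
  have h₂' := Rank2Observatory.onCurveZ_spec e h₂
  have h₄' := Rank2Observatory.onCurveZ_spec e h₄
  haveI := Rank2Observatory.isElliptic_rat e hΔ
  haveI : Fact (Nat.Prime 7) := ⟨by norm_num⟩
  set T : (e.map (Int.castRingHom ℚ)).toAffine.Point :=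
    .some _ _ (Rank2Observatory.nonsingular_rat_of_eq e hΔ h₁') with hT
  have hd₁ := Rank2Observatory.some_add_self_of_intTangent e hΔ h₁' h₂' t₁
  have hd₂ := Rank2Observatory.some_add_self_of_intTangent e hΔ h₂' h₄' t₂
  have hd₄ := Rank2Observatory.some_add_self_of_intTangent e hΔ h₄' h₁' t₄
  have h2 : (2 : ℕ) • T = .some _ _ (Rank2Observatory.nonsingular_rat_of_eq e hΔ h₂') := by
    rw [two_nsmul]; exact hd₁
  have h4 : (4 : ℕ) • T = .some _ _ (Rank2Observatory.nonsingular_rat_of_eq e hΔ h₄') := by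
    rw [show (4 : ℕ) = 2 + 2 from rfl, add_nsmul, h2]; exact hd₂
  have h8 : (8 : ℕ) • T = T := by
    rw [show (8 : ℕ) = 4 + 4 from rfl, add_nsmul, h4]; exact hd₄
  have h78 : (7 : ℕ) • T + T = 0 + T := by rw [← succ_nsmul, zero_add]; exact h8
  exact ⟨T, addOrderOf_eq_prime (add_right_cancel h78) (Affine.Point.some_ne_zero _)⟩

/-- **A rational point of ORDER `7` on `546f1` — IN THE KERNEL**: `T = (42, -168)`, `2T = (336, 6006)`, `4T = (84, 714)`, `8T = T`
(three tangent certificates decided on the integer model; transport lemma of the 395c1 file; no torsion theorem named).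
[cite: SilvermanAEC2009, III.2.3] -/
theorem exists_addOrderOf_eq_seven_546f1 : ∃ T : (⟨1, 0, 0, 714, -82908⟩ : WeierstrassCurve ℚ).toAffine.Point, addOrderOf T = 7 := by
  have hΔ : (⟨1, 0, 0, 714, -82908⟩ : WeierstrassCurve ℤ).Δ ≠ 0 := by rw [intCurve_Δ]; decide +kernel
  exact EisensteinPrimesMazurMCOnCellBTwistbackUnitEndP5Cell395c1.exists_addOrderOf_eq_of_curve_eq (map_mk_int 1 0 0 714 (-82908))
    (exists_addOrderOf_eq_seven_of_intTangent (x₁ := 42) (y₁ := (-168)) (x₂ := 336) (y₂ := 6006)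
      (x₄ := 84) (y₄ := 714) hΔ (by decide +kernel) (by decide +kernel) (by decide +kernel) (by decide +kernel)
      (by decide +kernel) (by decide +kernel))

/-- **`546f1[5]` is reducible — IN THE KERNEL** (a rational point of order `7` spans a Galois-stable line; Mazur's torsion–Galois
structure lemma of the tree, no named fact). [cite: Mazur1977, Ch. III §5, p. 157] -/
theorem not_irreducible_546f1 : ¬ (⟨1, 0, 0, 714, -82908⟩ : WeierstrassCurve ℚ).HasIrreducibleModPGaloisRep 7 := by
  haveI := isElliptic_546f1
  obtain ⟨T, hT⟩ := exists_addOrderOf_eq_seven_546f1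
  exact not_hasIrreducibleModPGaloisRep_of_addOrderOf_eq _ hT

/-- **`¬ GVPar (546f1) 5` IN THE KERNEL**: the rational `7`-torsion point spans a rational line that is unramified at `7` and
even, hence of co-type, and at the odd SPLIT multiplicative prime `7` one co-type line forces type A
(`X2.not_gvPar_of_nsmul_eq_zero_of_mult`, Tate uniformisation `hT`, `hT'`; same shape as the `p = 3` displays).
[cite: GreenbergVatsal2000, Thm. (1.3) and §2 p. 28] [cite: SilvermanATAEC1994, Thm. V.5.3 and Cor. V.5.4] -/
theorem not_gvPar_546f1
    (hT : Silverman1994_thmV53_corV54_tateUniformisation.{0})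
    (hT' : Silverman1994_thmV53_tateUniformisation.{0}) :
    ¬ GVPar (⟨1, 0, 0, 714, -82908⟩ : WeierstrassCurve ℚ) 7 := by
  haveI := isElliptic_546f1
  haveI := isGloballyMinimal_546f1
  obtain ⟨T, hT5⟩ := exists_addOrderOf_eq_seven_546f1
  have h5 : (7 : ℕ) • T = 0 := hT5 ▸ addOrderOf_nsmul_eq_zero T
  have h0 : T ≠ 0 := by
    rintro rfl
    rw [addOrderOf_zero] at hT5
    exact absurd hT5 (by norm_num)
  exact not_gvPar_of_nsmul_eq_zero_of_mult _ hT' hT (by decide) split_546f1.hasMultiplicativeReductionAtPrime _ h0 h5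

/-- **`X2.CellB (546f1) 5` from the rank reading alone**: `7 ≠ 2`, `E[7]` reducible (`not_irreducible_546f1`), `7` multiplicative
(`split_546f1`), `¬ GVPar` (`not_gvPar_546f1`, the Tate-uniformisation facts discharged by the tree's `_holds` theorems).
[cite: GreenbergVatsal2000, Thm. (1.3) and §2 p. 28] [cite: SilvermanATAEC1994, Thm. V.5.3 and Cor. V.5.4] -/
theorem cellB_546f1_of_analyticRank
    (hr : (⟨1, 0, 0, 714, -82908⟩ : WeierstrassCurve ℚ).analyticRank = 0) :
    X2.CellB (⟨1, 0, 0, 714, -82908⟩ : WeierstrassCurve ℚ) 7 :=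
  ⟨hr, ⟨by decide, not_irreducible_546f1, split_546f1.hasMultiplicativeReductionAtPrime⟩,
    not_gvPar_546f1 Silverman1994_thmV53_corV54_tateUniformisation_holds
      Silverman1994_thmV53_tateUniformisation_holds⟩

/-- The primes dividing `|Δ(546f1)| = 2⁷·3⁷·7⁷·13` are `2, 3, 7, 13`. [folklore] -/
private theorem eq_of_prime_dvd_disc {q : ℕ} (hq : q.Prime) (h : q ∣ 2 ^ 7 * 3 ^ 7 * 7 ^ 7 * 13 ^ 1) :
    q = 2 ∨ q = 3 ∨ q = 7 ∨ q = 13 := by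
  have hp : ∀ {r n : ℕ}, r.Prime → q ∣ r ^ n → q = r := fun hr hd ↦
    (Nat.prime_dvd_prime_iff_eq hq hr).mp (hq.dvd_of_dvd_pow hd)
  rcases (Nat.Prime.dvd_mul hq).mp h with h | h13
  swap
  · exact Or.inr (Or.inr (Or.inr (hp (by norm_num) h13)))
  rcases (Nat.Prime.dvd_mul hq).mp h with h | h7
  swap
  · exact Or.inr (Or.inr (Or.inl (hp (by norm_num) h7)))
  rcases (Nat.Prime.dvd_mul hq).mp h with h | h3
  swap
  · exact Or.inr (Or.inl (hp Nat.prime_three h3))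
  exact Or.inl (hp Nat.prime_two h)

/-- **Good reduction of `546f1` at every prime `q ∉ {2, 3, 7, 13}`** (`|Δ| = 2⁷·3⁷·7⁷·13`).
[cite: SilvermanAEC2009, VII.5 Prop. 5.1(a)] -/
theorem hasGoodReductionAtPrime_546f1 (q : ℕ) [hq : Fact q.Prime]
    (h2 : q ≠ 2) (h3 : q ≠ 3) (h7 : q ≠ 7) (h13 : q ≠ 13) :
    (⟨1, 0, 0, 714, -82908⟩ : WeierstrassCurve ℚ).HasGoodReductionAtPrime q := by
  obtain ⟨v, hv⟩ : ∃ v : HeightOneSpectrum (𝓞 ℚ), (Rat.HeightOneSpectrum.primesEquiv v : ℕ) = q :=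
    ⟨Rat.HeightOneSpectrum.primesEquiv.symm ⟨q, hq.out⟩, by rw [Equiv.apply_symm_apply]⟩
  subst hv
  have hΔ : ¬ ((Rat.HeightOneSpectrum.primesEquiv v : ℕ) : ℤ) ∣
      (⟨1, 0, 0, 714, -82908⟩ : WeierstrassCurve ℤ).Δ := by
    intro h
    rw [intCurve_Δ, Int.natCast_dvd] at h
    have habs : (discOf [1, 0, 0, 714, -82908]).natAbs = 2 ^ 7 * 3 ^ 7 * 7 ^ 7 * 13 ^ 1 := by
      decide +kernel
    rcases eq_of_prime_dvd_disc hq.out (habs ▸ h) with h | h | h | h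
    · exact h2 h
    · exact h3 h
    · exact h7 h
    · exact h13 h
  have hg := hasGoodReductionAt_map_of_not_dvd _ v hΔ
  rw [map_mk_int] at hg
  exact (hasGoodReductionAtPrime_iff_hasGoodReductionAt_ringOfIntegers v _).2 hg

/-- **Heegner hypothesis for `N_{546f1}` in a quadratic field from `d_K ≡ 1 (mod 8)` and Kronecker symbols at `3, 7, 13`** — no conductor
reading: a prime dividing the conductor is a prime of bad reduction (`dvd_conductorNorm_iff_not_hasGoodReductionAtPrime`), hence one
of `2, 3, 7, 13` (`hasGoodReductionAtPrime_546f1`). [cite: GrossLMS1991, §1 (p. 235)] [cite: SilvermanAEC2009, VII.5 Prop. 5.1(a)] -/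
theorem satisfiesHeegnerHypothesis_conductorNorm_546f1 {K : Type} [Field K] [NumberField K]
    (h2 : Module.finrank ℚ K = 2) (h8 : NumberField.discr K % 8 = 1) (h3 : jacobiSym (NumberField.discr K) 3 = 1) (h7 : jacobiSym (NumberField.discr K) 7 = 1) (h13 : jacobiSym (NumberField.discr K) 13 = 1) :
    SatisfiesHeegnerHypothesis ((⟨1, 0, 0, 714, -82908⟩ : WeierstrassCurve ℚ).conductorNorm ℤ) K := by
  haveI := isElliptic_546f1
  refine (satisfiesHeegnerHypothesis_iff_kronecker _ K h2).mpr fun p hp hpN ↦ ?_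
  haveI : Fact p.Prime := ⟨hp⟩
  have hbad : ¬ (⟨1, 0, 0, 714, -82908⟩ : WeierstrassCurve ℚ).HasGoodReductionAtPrime p :=
    (WeierstrassCurve.dvd_conductorNorm_iff_not_hasGoodReductionAtPrime _ p).mp hpN
  by_cases hp2 : p = 2
  · subst hp2; exact ⟨fun _ ↦ h8, fun h ↦ absurd rfl h⟩
  by_cases hp3 : p = 3
  · subst hp3; exact ⟨fun h ↦ absurd h (by norm_num), fun _ ↦ h3⟩
  by_cases hp7 : p = 7
  · subst hp7; exact ⟨fun h ↦ absurd h (by norm_num), fun _ ↦ h7⟩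
  by_cases hp13 : p = 13
  · subst hp13; exact ⟨fun h ↦ absurd h (by norm_num), fun _ ↦ h13⟩
  exact absurd (hasGoodReductionAtPrime_546f1 p hp2 hp3 hp7 hp13) hbad

end Summit.BirchSwinnertonDyer.BirchSwinnertonDyer.Theorems.EisensteinPrimesMazurMCOnCellBTwistbackUnitEndP7Cell546f1
end
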